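import Mathlib
import Summits.NavierStokesRegularity.NavierStokesRegularity.Theorems.EulerZoomLiouvillePowerGaugeEulerLiouvilleDSSEndpointShellTools
import Summits.NavierStokesRegularity.NavierStokesRegularity.Theorems.EulerZoomLiouvillePowerGaugeEulerLiouvilleDSSEndpointDecayTools
import HarnessLib

/-!
# Rung C2 of the crux `EulerZoomLiouville.PowerGaugeEulerLiouville` at the endpoint `ρ = 1/2`:
# the period-integrated cubic + pressure flux of a scale

Route №10 `EulerZoomLiouville` (NavierStokesRegularity), crux E = stmt-NavierStokesRegularity-19832,
tenure rung C2 (`Sig.rungC2_dss`) at the energy-conserving endpoint `ρ = 1/2`.  Second brick of the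
DSS endpoint stratum (`…DSSEndpointShell` → this file → `…DSSEndpointDecay` → `…DSSEndpointMember`):
the one-slice cubic/pressure shell bound of the lineage (`exists_shell_flux_consts`) INTEGRATED over
a time interval `I = (α, τ₀)` of the slab, for a suitable weak pair whose slices on `I` have energy
`≤ E₀`, `|u|³, |p||u| ∈ L¹_loc`, the sublinear far-field bound and the Riesz representation of the
pressure at large scales:

* `period_sliceSetEnergy` — the slice energies `τ ↦ ∫_A |u(τ)|²` are integrable on `I`, with values
  in `[0, E₀]` a.e.;
* `period_flux_le` — there are `a, b ≥ 0` with, for all scales `L, M` such that the shell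
  `T_M = {M/8 ≤ |y| < 32M}` lies in the dyadic window of width `2^m` around `L` (and `R₀ ≤ M/8`,
  `R₁ ≤ 32M`):
  `∫_I ∫_{M ≤ |y| ≤ 2M} (|u|³ + 2|p||u|) ≤ a M^{1−δ} S(L) + b M^{−3/2} E₀ √(|I| S(L))`,
  `S(L) = Σ_{k=0}^{2m} ∫_I ∫_{2^k L/2^m ≤ |y| < 2^{k+1}L/2^m} |u|²` the period window sum
  (Cauchy–Schwarz in time for the far-field square root, the dyadic covering slice by slice).

No self-similarity is used here.  WHAT THIS IS NOT: not NS, not E, not rung C2 — bookkeeping for one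
endpoint stratum.
-/

noncomputable section

-- flat `Theorems/<Route><Decl>…` files of one crux share the namespace of the crux (tree convention)
set_option linter.dupNamespace false

open MeasureTheory Set Filter Topology Metric Function TopologicalSpace Finset
open scoped ENNReal NNReal InnerProductSpace RealInnerProductSpace

namespace Summit.NavierStokesRegularity.NavierStokesRegularity.Theorems.PowerGaugeEulerLiouville

open Literature.Analysis Literature.Analysis.FunctionSpaces Literature.Analysis.FluidPDE

section PeriodFlux

variable {u : ℝ → EuclideanSpace ℝ (Fin 3) → EuclideanSpace ℝ (Fin 3)}
  {p : ℝ → EuclideanSpace ℝ (Fin 3) → ℝ}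

/-- **Slice energies on a set, integrated in time.**  If a.e. slice `u(τ)` (`τ < 0`) has
`∫ |u(τ)|² ≤ E₀` and `u` is a.e.-strongly measurable on the slab, then for a time interval
`I = (α, β)`, `β < 0`, and a measurable `A ⊆ ℝ³`, `τ ↦ ∫_A |u(τ)|²` is integrable on `I` with values
in `[0, E₀]` for a.e. `τ ∈ I`. [folklore] -/
theorem period_sliceSetEnergy
    (hum : AEStronglyMeasurable (uncurry u)
      (volume.restrict (Iio (0 : ℝ) ×ˢ (univ : Set (EuclideanSpace ℝ (Fin 3))))))
    {E₀ : ℝ} (hE : ∀ᵐ τ : ℝ, τ < 0 → Integrable (fun y => ‖u τ y‖ ^ 2) volume ∧ ∫ y, ‖u τ y‖ ^ 2 ≤ E₀)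
    {α β : ℝ} (hβ : β < 0) {A : Set (EuclideanSpace ℝ (Fin 3))} (hA : MeasurableSet A) :
    IntegrableOn (fun τ => ∫ y in A, ‖u τ y‖ ^ 2) (Ioo α β) volume ∧
      (∀ᵐ τ : ℝ, τ ∈ Ioo α β → 0 ≤ ∫ y in A, ‖u τ y‖ ^ 2 ∧ ∫ y in A, ‖u τ y‖ ^ 2 ≤ E₀) ∧
      0 ≤ ∫ τ in Ioo α β, ∫ y in A, ‖u τ y‖ ^ 2 := by
  have hI0 : Ioo α β ⊆ Iio 0 := fun t ht => ht.2.trans hβ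
  have hb2 : ∀ᵐ τ : ℝ, τ ∈ Ioo α β → 0 ≤ ∫ y in A, ‖u τ y‖ ^ 2 ∧ ∫ y in A, ‖u τ y‖ ^ 2 ≤ E₀ := by
    filter_upwards [hE] with τ hτ hτI
    obtain ⟨hi, hiE⟩ := hτ (hI0 hτI)
    exact ⟨setIntegral_nonneg hA fun y _ => by positivity,
      (setIntegral_le_integral hi (Eventually.of_forall fun y => by positivity)).trans hiE⟩
  refine ⟨?_, hb2, setIntegral_nonneg measurableSet_Ioo fun τ _ => setIntegral_nonneg hA
    fun y _ => by positivity⟩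
  refine Integrable.mono' (integrable_const E₀) (aestronglyMeasurable_sliceSetEnergy hum hI0 hA) ?_
  rw [ae_restrict_iff' measurableSet_Ioo]
  filter_upwards [hb2] with τ hτ hτI
  rw [Real.norm_eq_abs, abs_of_nonneg (hτ hτI).1]; exact (hτ hτI).2

/-- **The period-integrated flux of a scale.**  See the module docstring.
[cite: ChaeShvydkoy2013, §3.1 proof of Thm. 3.1] -/
theorem period_flux_le
    (hsw : IsSuitableWeakSolutionOn (slab (EuclideanSpace ℝ (Fin 3)) (Iio 0) isOpen_Iio) 0 0 u p)
    {α τ₀ : ℝ} (hτ₀ : τ₀ < 0) (hα : α < τ₀) {E₀ : ℝ}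
    (hE : ∀ᵐ τ : ℝ, τ < 0 → Integrable (fun y => ‖u τ y‖ ^ 2) volume ∧ ∫ y, ‖u τ y‖ ^ 2 ≤ E₀)
    (h3 : ∀ᵐ τ : ℝ, τ < 0 → LocallyIntegrable (fun y => ‖u τ y‖ ^ 3) volume)
    (hPV : ∀ᵐ τ : ℝ, τ < 0 → LocallyIntegrable (fun y => |p τ y| * ‖u τ y‖) volume)
    {δ Cup R₀ : ℝ} (hδ1 : δ ≤ 1) (hCup : 0 ≤ Cup)
    (hup : ∀ᵐ τ : ℝ, τ ∈ Ioo α τ₀ → ∀ᵐ y ∂volume, R₀ ≤ ‖y‖ → ‖u τ y‖ ≤ Cup * ‖y‖ ^ (1 - δ))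
    {R₁ : ℝ}
    (hPR : ∀ᵐ τ : ℝ, τ ∈ Ioo α τ₀ → ∀ R : ℝ, R₁ ≤ R → ∀ᵐ y ∂volume, ‖y‖ < R / 2 →
      p τ y = rieszPressure ((ball (0 : EuclideanSpace ℝ (Fin 3)) R).indicator (u τ)) y +
        ∫ z in {z | R ≤ ‖z‖}, pressureKernel (y - z) (u τ z))
    (m : ℕ) :
    ∃ a b : ℝ, 0 ≤ a ∧ 0 ≤ b ∧ ∀ L M : ℝ, 0 < L → 0 < M → R₀ ≤ M / 8 → R₁ ≤ 32 * M →
      L / 2 ^ m ≤ M / 8 → 32 * M ≤ 2 ^ (m + 1) * L →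
      ∫ τ in Ioo α τ₀, ∫ y in {y : EuclideanSpace ℝ (Fin 3) | M ≤ ‖y‖ ∧ ‖y‖ ≤ 2 * M},
          (‖u τ y‖ ^ 3 + 2 * (|p τ y| * ‖u τ y‖)) ≤
        a * M ^ (1 - δ) * (∑ k ∈ range (2 * m + 1), ∫ τ in Ioo α τ₀,
            ∫ y in {y : EuclideanSpace ℝ (Fin 3) | 2 ^ k * L / 2 ^ m ≤ ‖y‖ ∧
              ‖y‖ < 2 * (2 ^ k * L / 2 ^ m)}, ‖u τ y‖ ^ 2) +
          b * M ^ (-(3 / 2 : ℝ)) * E₀ * Real.sqrt ((τ₀ - α) *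
            ∑ k ∈ range (2 * m + 1), ∫ τ in Ioo α τ₀,
              ∫ y in {y : EuclideanSpace ℝ (Fin 3) | 2 ^ k * L / 2 ^ m ≤ ‖y‖ ∧
                ‖y‖ < 2 * (2 ^ k * L / 2 ^ m)}, ‖u τ y‖ ^ 2) := by
  set I₀ : Set ℝ := Ioo α τ₀ with hI₀
  set T : ℝ := τ₀ - α with hT
  have hT0 : 0 < T := by rw [hT]; linarith
  have hTvol : volume.real I₀ = T := Real.volume_real_Ioo_of_le hα.le
  have hI₀0 : I₀ ⊆ Iio 0 := fun t ht => ht.2.trans hτ₀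
  obtain ⟨C_S, hCS⟩ := exists_eLpNorm_rieszPressure_two_le
  obtain ⟨a, bb, ha0, hbb0, hflux⟩ := exists_shell_flux_consts C_S hδ1 hCup
  have hum : AEStronglyMeasurable (uncurry u)
      (volume.restrict (Iio (0 : ℝ) ×ˢ (univ : Set (EuclideanSpace ℝ (Fin 3))))) := by
    obtain ⟨G, hG, -, -⟩ := hsw.localEnergy
    simpa [slab] using hG.locallyIntegrableOn.aestronglyMeasurable
  obtain ⟨C', hslice⟩ := exists_ae_slice_energy_facts hsw (α := α) hτ₀ 1
  have hW := fun (A : Set (EuclideanSpace ℝ (Fin 3))) (hA : MeasurableSet A) =>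
    period_sliceSetEnergy hum hE (α := α) hτ₀ hA
  have hshellm : ∀ A B : ℝ, MeasurableSet {y : EuclideanSpace ℝ (Fin 3) | A ≤ ‖y‖ ∧ ‖y‖ < B} :=
    fun A B => (measurableSet_le measurable_const measurable_norm).inter
      (measurableSet_lt measurable_norm measurable_const)
  refine ⟨a, bb, ha0, hbb0, fun L M hL hM hMR₀ hMR₁ hwA hwB => ?_⟩
  set S : ℝ := ∑ k ∈ range (2 * m + 1), ∫ τ in I₀,
    ∫ y in {y : EuclideanSpace ℝ (Fin 3) | 2 ^ k * L / 2 ^ m ≤ ‖y‖ ∧ ‖y‖ < 2 * (2 ^ k * L / 2 ^ m)},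
      ‖u τ y‖ ^ 2 with hS
  set TM : Set (EuclideanSpace ℝ (Fin 3)) := {y | M / 8 ≤ ‖y‖ ∧ ‖y‖ < 32 * M} with hTM
  obtain ⟨hWi, hWb, hW0⟩ := hW TM (hshellm _ _)
  -- the window covers `T_M`
  have hWS : ∫ τ in I₀, ∫ y in TM, ‖u τ y‖ ^ 2 ≤ S := by
    have hint : ∀ k ∈ range (2 * m + 1), IntegrableOn (fun τ =>
        ∫ y in {y : EuclideanSpace ℝ (Fin 3) | 2 ^ k * L / 2 ^ m ≤ ‖y‖ ∧
          ‖y‖ < 2 * (2 ^ k * L / 2 ^ m)}, ‖u τ y‖ ^ 2) I₀ volume :=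
      fun k _ => (hW _ (hshellm _ _)).1
    calc ∫ τ in I₀, ∫ y in TM, ‖u τ y‖ ^ 2
        ≤ ∫ τ in I₀, ∑ k ∈ range (2 * m + 1),
            ∫ y in {y : EuclideanSpace ℝ (Fin 3) | 2 ^ k * L / 2 ^ m ≤ ‖y‖ ∧
              ‖y‖ < 2 * (2 ^ k * L / 2 ^ m)}, ‖u τ y‖ ^ 2 := by
          refine setIntegral_mono_ae_restrict hWi (integrable_finsetSum _ hint)
            ((ae_restrict_iff' measurableSet_Ioo).2 ?_)
          filter_upwards [hE] with τ hτ hτI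
          exact setIntegral_le_windowSum (fun y => by positivity) (hτ (hI₀0 hτI)).1 hL m hwA hwB
      _ = S := by rw [integral_finsetSum _ hint]
  have hS0 : 0 ≤ S := hW0.trans hWS
  -- one slice
  have hpt : ∀ᵐ τ : ℝ, τ ∈ I₀ →
      ∫ y in {y : EuclideanSpace ℝ (Fin 3) | M ≤ ‖y‖ ∧ ‖y‖ ≤ 2 * M},
          (‖u τ y‖ ^ 3 + 2 * (|p τ y| * ‖u τ y‖)) ≤
        a * M ^ (1 - δ) * (∫ y in TM, ‖u τ y‖ ^ 2) +
          bb * M ^ (-(3 / 2 : ℝ)) * E₀ * Real.sqrt (∫ y in TM, ‖u τ y‖ ^ 2) := by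
    filter_upwards [hslice, hE, h3, hPV, hup, hPR] with τ hsl hEτ h3τ hPVτ hupτ hPRτ hτI
    have hτ0 : τ < 0 := hI₀0 hτI
    obtain ⟨hsm, -, -, -⟩ := hsl hτI
    obtain ⟨hi2, hiE⟩ := hEτ hτ0
    have hPτ : ∀ᵐ y ∂volume, ‖y‖ < 16 * M →
        p τ y = rieszPressure ((ball (0 : EuclideanSpace ℝ (Fin 3)) (32 * M)).indicator (u τ)) y +
          ∫ z in {z | 32 * M ≤ ‖z‖}, pressureKernel (y - z) (u τ z) := by
      filter_upwards [hPRτ hτI (32 * M) hMR₁] with y hy h16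
      exact hy (by linarith)
    have key := hflux (u τ) (p τ) hCS hsm hi2 (h3τ hτ0) (hPVτ hτ0) (hupτ hτI) hM hMR₀ hPτ
    have hmono : bb * M ^ (-(3 / 2 : ℝ)) * (∫ z, ‖u τ z‖ ^ 2) * Real.sqrt (∫ y in TM, ‖u τ y‖ ^ 2) ≤
        bb * M ^ (-(3 / 2 : ℝ)) * E₀ * Real.sqrt (∫ y in TM, ‖u τ y‖ ^ 2) :=
      mul_le_mul_of_nonneg_right (mul_le_mul_of_nonneg_left hiE (by positivity)) (Real.sqrt_nonneg _)
    exact key.trans (by linarith [hmono])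
  -- integrability in `τ`
  have hsq : IntegrableOn (fun τ => Real.sqrt (∫ y in TM, ‖u τ y‖ ^ 2)) I₀ volume := by
    refine Integrable.mono' (integrable_const (Real.sqrt E₀))
      (Real.continuous_sqrt.comp_aestronglyMeasurable hWi.aestronglyMeasurable) ?_
    rw [ae_restrict_iff' measurableSet_Ioo]
    filter_upwards [hWb] with τ hτ hτI
    rw [Real.norm_eq_abs, abs_of_nonneg (Real.sqrt_nonneg _)]
    exact Real.sqrt_le_sqrt (hτ hτI).2
  have hFI : IntegrableOn (fun τ => ∫ y in {y : EuclideanSpace ℝ (Fin 3) | M ≤ ‖y‖ ∧ ‖y‖ ≤ 2 * M},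
      (‖u τ y‖ ^ 3 + 2 * (|p τ y| * ‖u τ y‖))) I₀ volume := by
    set K' : Set (ℝ × EuclideanSpace ℝ (Fin 3)) :=
      Icc α τ₀ ×ˢ closedBall (0 : EuclideanSpace ℝ (Fin 3)) (2 * M) with hK'
    have hK'c : IsCompact K' := isCompact_Icc.prod (isCompact_closedBall _ _)
    have hK'S : K' ⊆ ((slab (EuclideanSpace ℝ (Fin 3)) (Iio 0) isOpen_Iio :
        Opens (ℝ × EuclideanSpace ℝ (Fin 3))) : Set (ℝ × EuclideanSpace ℝ (Fin 3))) := by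
      rintro ⟨t, x⟩ ⟨ht, -⟩
      rw [SetLike.mem_coe, mem_slab]
      exact lt_of_le_of_lt ht.2 hτ₀
    have hFK : IntegrableOn (fun z : ℝ × EuclideanSpace ℝ (Fin 3) =>
        ‖u z.1 z.2‖ ^ 3 + 2 * (|p z.1 z.2| * ‖u z.1 z.2‖))
        (I₀ ×ˢ {y : EuclideanSpace ℝ (Fin 3) | M ≤ ‖y‖ ∧ ‖y‖ ≤ 2 * M}) volume :=
      (((locallyIntegrableOn_cube_of_suitable hsw).integrableOn_compact_subset hK'S hK'c).add
        ((integrableOn_pressure_velocity_of_suitable hsw hK'c hK'S).const_mul 2)).mono_set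
        (prod_mono Ioo_subset_Icc_self fun y hy => by
          rw [mem_closedBall, dist_zero_right]; exact hy.2)
    have h : Integrable (fun z : ℝ × EuclideanSpace ℝ (Fin 3) =>
        ‖u z.1 z.2‖ ^ 3 + 2 * (|p z.1 z.2| * ‖u z.1 z.2‖))
        ((volume.restrict I₀).prod
          (volume.restrict {y : EuclideanSpace ℝ (Fin 3) | M ≤ ‖y‖ ∧ ‖y‖ ≤ 2 * M})) := by
      rw [Measure.prod_restrict, ← Measure.volume_eq_prod]; exact hFK
    exact h.integral_prod_left
  have hsqrt : ∫ τ in I₀, Real.sqrt (∫ y in TM, ‖u τ y‖ ^ 2) ≤ Real.sqrt (T * S) := by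
    have hvol : volume I₀ ≠ ⊤ := by rw [hI₀, Real.volume_Ioo]; exact ENNReal.ofReal_ne_top
    refine (integral_sqrt_le hvol ((ae_restrict_iff' measurableSet_Ioo).2 (by
      filter_upwards [hWb] with τ hτ hτI; exact (hτ hτI).1)) hWi).trans ?_
    rw [hTvol]
    exact Real.sqrt_le_sqrt (mul_le_mul_of_nonneg_left hWS hT0.le)
  calc ∫ τ in I₀, ∫ y in {y : EuclideanSpace ℝ (Fin 3) | M ≤ ‖y‖ ∧ ‖y‖ ≤ 2 * M},
        (‖u τ y‖ ^ 3 + 2 * (|p τ y| * ‖u τ y‖))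
      ≤ ∫ τ in I₀, (a * M ^ (1 - δ) * (∫ y in TM, ‖u τ y‖ ^ 2) +
          bb * M ^ (-(3 / 2 : ℝ)) * E₀ * Real.sqrt (∫ y in TM, ‖u τ y‖ ^ 2)) :=
        setIntegral_mono_ae_restrict hFI ((hWi.const_mul _).add (hsq.const_mul _))
          ((ae_restrict_iff' measurableSet_Ioo).2 hpt)
    _ = a * M ^ (1 - δ) * (∫ τ in I₀, ∫ y in TM, ‖u τ y‖ ^ 2) +
        bb * M ^ (-(3 / 2 : ℝ)) * E₀ * ∫ τ in I₀, Real.sqrt (∫ y in TM, ‖u τ y‖ ^ 2) := by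
        rw [integral_add (hWi.const_mul _) (hsq.const_mul _), integral_const_mul, integral_const_mul]
    _ ≤ a * M ^ (1 - δ) * S + bb * M ^ (-(3 / 2 : ℝ)) * E₀ * Real.sqrt (T * S) := by
        have hE₀ : 0 ≤ E₀ := by
          have hne : (ae ((volume : Measure ℝ).restrict I₀)).NeBot := by
            rw [ae_neBot, Ne, Measure.restrict_eq_zero, Real.volume_Ioo, ENNReal.ofReal_eq_zero,
              not_le]; linarith
          obtain ⟨τ, hτ, hτI⟩ := ((ae_restrict_of_ae hE : ∀ᵐ τ ∂(volume.restrict I₀), _).and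
            (ae_restrict_mem measurableSet_Ioo)).exists
          exact (integral_nonneg fun y => by positivity).trans (hτ (hI₀0 hτI)).2
        gcongr

end PeriodFlux

end Summit.NavierStokesRegularity.NavierStokesRegularity.Theorems.PowerGaugeEulerLiouville
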